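import Literature.NumberTheory.EllipticCurves.ModularFunctionFieldPoints
import Literature.NumberTheory.EllipticCurves.HeckeOperatorsProofs
import Literature.NumberTheory.DiophantineGeometry.FunctionFieldGenusApproximationProofs
import HarnessLib

/-!
# Uniformizers of the places `P_τ` of the modular function field `K_N`: the operator `V_N`,
  `E₆(Nτ) ≠ 0` / `E₄(Nτ) ≠ 0` at non-elliptic points above `j = 1728, 0`, and
  `ord_{P_τ} = ordAtN τ` (trunk EllArithM; layer 5 of the Riemann–Roch bridge to
  `dim S₂(Γ₀(N)) = g(X₀(N))`)

`ModularFunctionFieldPoints` constructs the place `P_τ` of `K_N/ℂ` at `τ ∈ ℍ` and shows that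
`j − j(τ)` is a uniformizer whenever its order `3, 2, 1` equals the period `e_τ`. The remaining
points are the non-elliptic points of `Γ₀(N)` in the `SL₂(ℤ)`-orbits of `i` and `ρ`, where `j − j(τ)`
vanishes to order `2`, `3` but `e_τ = 1`. This file completes the normalisation there with the
level-raising operator:

* `exists_tpD_mul_eq_mul_upper`: Hermite decomposition `D_aγ = γ'M`, `M` upper triangular with positive
  diagonal (`D_a = diag(a, 1)` is the tree's `tpD`).
* `scaleN N f : ModularForm (Γ₀(N)) k`, **`(V_N f)(τ) = f(Nτ)`** for a level-one form `f`
  (Diamond–Shurman §5.7, Shimura Prop. 3.36), with `orderAt_scaleN : ord_τ(V_N f) = ord_{Nτ}(f)`.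
* `entries_of_smul_I_eq`, `entries_of_smul_rho_eq`, `mul_S_eq_of_smul_I_eq`,
  `mul_ST_eq_of_smul_rho_eq`: real matrices of positive determinant fixing `i` (resp. `ρ`) are
  `(a b; −b a)` (resp. `(d−c, −c; c, d)`) and commute with `S` (resp. `ST`).
* `conj_mem_gamma0_of_smul_eq`: **the key lemma** — if `δ·P = D_N·(k·P)` with `X` fixing `P` and
  the isotropy of `P` abelian, then `kXk⁻¹ ∈ Γ₀(N)`; hence `E₆_tpD_smul_ne_zero`,
  `E₄_tpD_smul_ne_zero`: **`E₆(Nτ) ≠ 0` at a non-elliptic `τ = k·i`, `E₄(Nτ) ≠ 0` at a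
  non-elliptic `τ = k·ρ`** (the CM description of the elliptic points of `X₀(N)`,
  Diamond–Shurman §3.7 / Ex. 1.5.6).
* `kleinJSub_eq : kleinJSub N τ₀ = kleinJK N − j(τ₀)` (link requested in review of
  `ModularFunctionFieldPoints`).
* `exists_uniformizer_of_E₆_eq_zero`, `exists_uniformizer_of_E₄_eq_zero` (`E₆(τ)/E₆(Nτ)`,
  `E₄(τ)/E₄(Nτ)` are uniformizers there), **`exists_pointValuation_eq_exp_neg_one`** (every `v_τ`
  is normalised), `pointValuation_uniformizer`, **`pointPlace_valuation_le_iff`** (the Riemann–Roch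
  condition at `P_τ` reads `−n ≤ ordAtN τ x`) and **`ord_pointPlace : ord_{P_τ}(x) = ordAtN τ x`**.

Everything is in `namespace Literature.ModularForms`; all statements are proved.

## References

* G. Shimura, *Introduction to the arithmetic theory of automorphic functions*, Princeton 1971,
  §1.5, Prop. 3.36.
* F. Diamond, J. Shurman, *A first course in modular forms*, GTM 228, Springer 2005, §1.5, §3.7, §5.7.
-/

noncomputable section

open UpperHalfPlane hiding I
open ModularForm SlashInvariantForm ModularFormClass Filter Function CongruenceSubgroup
  EisensteinSeries Polynomial ModularGroup Matrix.SpecialLinearGroup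
open scoped MatrixGroups Real Topology Manifold IntermediateField WithZero

namespace Literature.NumberTheory.EllipticCurves.ModularForms

/-! ### The level-raising operator `V_N : f ↦ f(Nτ)` on level-one forms -/

section Scale

/-- **Hermite decomposition** `D_a γ = γ' M` for `γ ∈ SL₂(ℤ)`, `D_a = diag(a, 1)`: `γ' ∈ SL₂(ℤ)`
and `M = (g m; 0 a/g)` upper triangular with positive diagonal (`g = gcd(aγ₀₀, γ₁₀)`, Bezout)
(Shimura Prop. 3.36 / the proof pattern of `ModularCurveEtaProductsProofs`). [folklore] -/
theorem exists_tpD_mul_eq_mul_upper (a : ℕ) [NeZero a] (γ : SL(2, ℤ)) :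
    ∃ (γ' : SL(2, ℤ)) (M : GL (Fin 2) ℝ), M 1 0 = 0 ∧ 0 < M.det.val ∧
      tpD a * mapGL ℝ γ = mapGL ℝ γ' * M := by
  have ha : 0 < (a : ℤ) := by exact_mod_cast Nat.pos_of_ne_zero (NeZero.ne a)
  have hdet : γ 0 0 * γ 1 1 - γ 0 1 * γ 1 0 = 1 := by
    have := Matrix.det_fin_two (γ : Matrix (Fin 2) (Fin 2) ℤ)
    rw [γ.det_coe] at this
    linarith
  set p : ℤ := a * γ 0 0 with hp
  set r : ℤ := γ 1 0 with hr
  set q : ℤ := a * γ 0 1 with hq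
  set s : ℤ := γ 1 1 with hs
  have hps : p * s - r * q = a := by
    simp only [hp, hr, hq, hs]; linear_combination (a : ℤ) * hdet
  set g : ℤ := (Int.gcd p r : ℤ) with hg
  have hg0 : g ≠ 0 := by
    intro h0
    have h0' : Int.gcd p r = 0 := by rw [hg] at h0; exact_mod_cast h0
    rw [Int.gcd_eq_zero_iff] at h0'
    have : (a : ℤ) = 0 := by rw [← hps, h0'.1, h0'.2]; ring
    exact ha.ne' this
  have hgpos : 0 < g := lt_of_le_of_ne (by simp [hg]) (Ne.symm hg0)
  obtain ⟨p', hp'⟩ : g ∣ p := Int.gcd_dvd_left ..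
  obtain ⟨r', hr'⟩ : g ∣ r := Int.gcd_dvd_right ..
  set x : ℤ := Int.gcdA p r
  set y : ℤ := Int.gcdB p r
  have hbez : p * x + r * y = g := (Int.gcd_eq_gcd_ab p r).symm
  have hbez' : p' * x + r' * y = 1 := by
    have : g * (p' * x + r' * y - 1) = 0 := by
      linear_combination (hp' ▸ hr' ▸ hbez : (g * p') * x + (g * r') * y = g)
    rcases mul_eq_zero.mp this with h | h
    · exact absurd h hg0
    · linarith
  set a' : ℤ := p' * s - r' * q with ha'
  have hga' : g * a' = a := by
    rw [ha', ← hps, hp', hr']; ring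
  have ha'pos : 0 < a' := by
    rcases lt_trichotomy a' 0 with h | h | h
    · nlinarith
    · rw [h, mul_zero] at hga'; linarith
    · exact h
  let γ' : SL(2, ℤ) := ⟨!![p', -y; r', x], by rw [Matrix.det_fin_two_of]; linear_combination hbez'⟩
  set m : ℤ := x * q + y * s with hm
  have hdetM : Matrix.det !![(g : ℝ), (m : ℝ); 0, (a' : ℝ)] ≠ 0 := by
    rw [Matrix.det_fin_two_of]
    have : (g : ℝ) * a' ≠ 0 := by exact_mod_cast (mul_pos hgpos ha'pos).ne'
    simpa using this
  let M : GL (Fin 2) ℝ := Matrix.GeneralLinearGroup.mkOfDetNeZero _ hdetM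
  have hMdet : 0 < M.det.val := by
    rw [Matrix.GeneralLinearGroup.val_det_apply]
    change 0 < Matrix.det !![(g : ℝ), (m : ℝ); 0, (a' : ℝ)]
    rw [Matrix.det_fin_two_of]
    have : (0 : ℝ) < g * a' := by exact_mod_cast mul_pos hgpos ha'pos
    simpa using this
  refine ⟨γ', M, by simp [M, Matrix.GeneralLinearGroup.mkOfDetNeZero], hMdet, ?_⟩
  ext i j
  simp only [Units.val_mul, Matrix.mul_apply, Fin.sum_univ_two, val_tpD]
  simp only [mapGL_coe_matrix, map_apply_coe, γ', M]
  have e00 : (a : ℝ) * (γ 0 0 : ℤ) = p' * g := by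
    have : (p : ℝ) = g * p' := by exact_mod_cast hp'
    rw [show (a : ℝ) * (γ 0 0 : ℤ) = p by rw [hp]; push_cast; ring, this]; ring
  have e10 : ((γ 1 0 : ℤ) : ℝ) = r' * g := by
    have : (r : ℝ) = g * r' := by exact_mod_cast hr'
    rw [show ((γ 1 0 : ℤ) : ℝ) = r by rw [hr], this]; ring
  have e01 : (a : ℝ) * (γ 0 1 : ℤ) = p' * m + (-y) * a' := by
    have h1 : (q : ℝ) = p' * m + (-y) * a' := by
      have : (q : ℤ) = p' * m + (-y) * a' := by
        rw [hm, ha']; linear_combination (-q) * hbez'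
      exact_mod_cast this
    rw [show (a : ℝ) * (γ 0 1 : ℤ) = q by rw [hq]; push_cast; ring, h1]
  have e11 : ((γ 1 1 : ℤ) : ℝ) = r' * m + x * a' := by
    have : (s : ℤ) = r' * m + x * a' := by
      rw [hm, ha']; linear_combination (-s) * hbez'
    have h1 : (s : ℝ) = r' * m + x * a' := by exact_mod_cast this
    rw [show ((γ 1 1 : ℤ) : ℝ) = s by rw [hs], h1]
  fin_cases i <;> fin_cases j <;>
    simp [Matrix.GeneralLinearGroup.mkOfDetNeZero, e00, e10, e01, e11]

variable (N : ℕ) [NeZero N]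

/-- `0 < det D_N`. [folklore] -/
theorem det_tpD_pos' : 0 < (tpD N).det.val := by
  rw [det_tpD]; exact_mod_cast Nat.pos_of_ne_zero (NeZero.ne N)

/-- For `γ = (a b; c d) ∈ Γ₀(N)`, the conjugate `D_N γ D_N⁻¹ = (a, Nb; c/N, d) ∈ SL₂(ℤ)` and the
relation `D_N γ = (D_N γ D_N⁻¹) D_N`. [folklore] -/
theorem exists_tpD_mul_eq_mul_tpD {γ : SL(2, ℤ)} (hγ : γ ∈ Gamma0 N) :
    ∃ γa : SL(2, ℤ), tpD N * mapGL ℝ γ = mapGL ℝ γa * tpD N := by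
  have hdet : γ 0 0 * γ 1 1 - γ 0 1 * γ 1 0 = 1 := by
    have := Matrix.det_fin_two (γ : Matrix (Fin 2) (Fin 2) ℤ)
    rw [γ.det_coe] at this
    linarith
  obtain ⟨c', hc⟩ : (N : ℤ) ∣ γ 1 0 :=
    (ZMod.intCast_zmod_eq_zero_iff_dvd _ N).mp (Gamma0_mem.mp hγ)
  let ga : SL(2, ℤ) := ⟨!![γ 0 0, N * γ 0 1; c', γ 1 1], by
    rw [Matrix.det_fin_two_of]
    linear_combination hdet + γ 0 1 * hc⟩
  refine ⟨ga, ?_⟩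
  ext i j
  simp only [Units.val_mul, Matrix.mul_apply, Fin.sum_univ_two, val_tpD]
  simp only [mapGL_coe_matrix, map_apply_coe, ga]
  have hc' : ((γ 1 0 : ℤ) : ℝ) = N * c' := by exact_mod_cast hc
  fin_cases i <;> fin_cases j <;> simp [hc'] <;> ring

/-- **The level-raising operator `V_N`**: for a level-one modular form `f` of weight `k`,
`τ ↦ f(Nτ)` is a modular form of weight `k` for `Γ₀(N)` (`= N^{1−k} f|_k D_N`, `D_N = diag(N, 1)`;
invariance since `D_N Γ₀(N) D_N⁻¹ ≤ SL₂(ℤ)`, boundedness at all cusps by the Hermite decomposition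
`D_N γ = γ' M`) (Diamond–Shurman §5.7 / Ex. 1.2.11; Shimura Prop. 3.36). The tree's
`NewformsLevelRaising.iota` is the analogous degeneracy map on *cusp* forms of level `Γ₀(M)`; here the
input is a level-one *modular* form (`E₄`, `E₆`), whence a separate (small) construction. [folklore] -/
def scaleN {k : ℤ} (f : ModularForm 𝒮ℒ k) : ModularForm (Gamma0 N) k where
  toFun τ := f (tpD N • τ)
  slash_action_eq' A hA := by
    obtain ⟨γ, hγ, rfl⟩ := hA
    obtain ⟨γa, hconj⟩ := exists_tpD_mul_eq_mul_tpD N hγ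
    have hF : (fun τ ↦ f (tpD N • τ)) = ((N : ℂ) ^ (1 - k)) • ((f : ℍ → ℂ) ∣[k] tpD N) := by
      funext τ
      rw [Pi.smul_apply, slash_tpD_apply, smul_eq_mul, ← mul_assoc,
        ← zpow_add₀ (by exact_mod_cast NeZero.ne N : (N : ℂ) ≠ 0), show 1 - k + (k - 1) = 0 by ring,
        zpow_zero, one_mul]
    have hγdet : 0 < (mapGL ℝ γ).det.val := by simp
    rw [hF, ModularForm.smul_slash, σ_eq_self hγdet, ← SlashAction.slash_mul, hconj,
      SlashAction.slash_mul, SlashInvariantForm.slash_action_eqn f (mapGL ℝ γa) (MonoidHom.mem_range.mpr ⟨γa, rfl⟩)]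
  holo' := (holo f).comp (mdifferentiable_smul (det_tpD_pos' N))
  bdd_at_cusps' {c} hc := by
    rw [OnePoint.isBoundedAt_iff_forall_SL2Z (hc.mono fun A hA ↦ by obtain ⟨γ, -, rfl⟩ := hA; exact ⟨γ, rfl⟩)]
    intro γ _
    obtain ⟨γ', M, hM10, hMdet, hdecomp⟩ := exists_tpD_mul_eq_mul_upper N γ
    have hF : (fun τ ↦ f (tpD N • τ)) = ((N : ℂ) ^ (1 - k)) • ((f : ℍ → ℂ) ∣[k] tpD N) := by
      funext τ
      rw [Pi.smul_apply, slash_tpD_apply, smul_eq_mul, ← mul_assoc,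
        ← zpow_add₀ (by exact_mod_cast NeZero.ne N : (N : ℂ) ≠ 0), show 1 - k + (k - 1) = 0 by ring,
        zpow_zero, one_mul]
    change IsBoundedAtImInfty (((fun τ ↦ f (tpD N • τ)) : ℍ → ℂ) ∣[k] (mapGL ℝ γ))
    have hγdet : 0 < (mapGL ℝ γ).det.val := by simp
    rw [hF, ModularForm.smul_slash, σ_eq_self hγdet, ← SlashAction.slash_mul, hdecomp, SlashAction.slash_mul,
      SlashInvariantForm.slash_action_eqn f (mapGL ℝ γ') (MonoidHom.mem_range.mpr ⟨γ', rfl⟩)]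
    exact (IsBoundedAtImInfty.slash k hM10 (ModularFormClass.bdd_at_infty f)).const_smul_left _

/-- `(V_N f)(τ) = f(N τ)`. [folklore] -/
@[simp] theorem scaleN_apply {k : ℤ} (f : ModularForm 𝒮ℒ k) (τ : ℍ) : scaleN N f τ = f (tpD N • τ) := rfl

/-- **Orders of vanishing under `V_N`**: `ord_τ(V_N f) = ord_{Nτ}(f)` (`τ ↦ Nτ` is a local
biholomorphism). [folklore] -/
theorem orderAt_scaleN {k : ℤ} (f : ModularForm 𝒮ℒ k) (τ : ℍ) :
    orderAt (scaleN N f) τ = (analyticOrderAt ((f : ℍ → ℂ) ∘ ofComplex) ↑(tpD N • τ)).toNat := by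
  unfold orderAt
  congr 1
  set g : ℂ → ℂ := fun z ↦ (((tpD N) • ofComplex z : ℍ) : ℂ) with hg
  have hga : AnalyticAt ℂ g τ := analyticAt_smul_ofComplex (det_tpD_pos' N) τ
  have hg' : deriv g τ ≠ 0 := deriv_smul_ne_zero (det_tpD_pos' N) τ
  have hgτ : g τ = ↑(tpD N • τ) := by simp [hg, ofComplex_apply]
  have heq : ((scaleN N f : ℍ → ℂ) ∘ ofComplex) =ᶠ[𝓝 (τ : ℂ)] (f ∘ ofComplex) ∘ g := by
    filter_upwards [isOpen_upperHalfPlaneSet.mem_nhds τ.im_pos] with z hz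
    simp [hg, ofComplex_apply_of_im_pos hz, ofComplex_apply]
  rw [analyticOrderAt_congr heq, analyticOrderAt_comp_of_deriv_ne_zero hga hg', hgτ]

/-- `V_N f ≠ 0` for `f ≠ 0`. [folklore] -/
theorem scaleN_ne_zero {k : ℤ} {f : ModularForm 𝒮ℒ k} (hf : f ≠ 0) : scaleN N f ≠ 0 := by
  intro h
  apply hf
  -- `f(N τ) = 0` for all `τ`, and `τ ↦ N τ` is onto `ℍ`
  apply DFunLike.ext' 
  funext τ
  have hN : (0 : ℝ) < N := by exact_mod_cast Nat.pos_of_ne_zero (NeZero.ne N)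
  let τ' : ℍ := ⟨(τ : ℂ) / N, by
    rw [Complex.div_natCast_im]; exact div_pos τ.im_pos hN⟩
  have hτ : tpD N • τ' = τ := by
    apply UpperHalfPlane.ext
    rw [coe_tpD_smul]
    exact mul_div_cancel₀ _ (by exact_mod_cast NeZero.ne N)
  have := congrArg (fun F : ModularForm (Gamma0 N) k ↦ F τ') h
  simpa [hτ] using this

end Scale


/-! ### Non-elliptic points above `j = 1728` and `j = 0`: `E₆(Nτ) ≠ 0`, `E₄(Nτ) ≠ 0` -/

section Stabilizer

variable (N : ℕ) [NeZero N]

/-- `a z + b = 0` with `a, b ∈ ℝ` and `z ∉ ℝ` forces `a = b = 0`. [folklore] -/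
theorem real_mul_add_eq_zero {z : ℂ} (hz : z.im ≠ 0) {a b : ℝ} (h : (a : ℂ) * z + b = 0) :
    a = 0 ∧ b = 0 := by
  have him := congrArg Complex.im h
  simp only [Complex.add_im, Complex.mul_im, Complex.ofReal_re, Complex.ofReal_im, zero_mul,
    add_zero, Complex.zero_im] at him
  have ha : a = 0 := by
    rcases mul_eq_zero.mp him with h0 | h0
    · exact h0
    · exact absurd h0 hz
  subst ha
  simp only [Complex.ofReal_zero, zero_mul, zero_add, Complex.ofReal_eq_zero] at h
  exact ⟨rfl, h⟩

/-- Entries of a real matrix of positive determinant fixing `i`: `(a b; −b a)`. [folklore] -/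
theorem entries_of_smul_I_eq {M : GL (Fin 2) ℝ} (hM : 0 < M.det.val) (h : M • UpperHalfPlane.I = UpperHalfPlane.I) :
    M 0 0 = M 1 1 ∧ M 0 1 = -M 1 0 := by
  have hc := congrArg UpperHalfPlane.coe h
  rw [coe_smul_of_det_pos hM, div_eq_iff (denom_ne_zero M _)] at hc
  simp only [num, denom, UpperHalfPlane.coe_I] at hc
  have key : ((M 0 0 - M 1 1 : ℝ) : ℂ) * Complex.I + ((M 0 1 + M 1 0 : ℝ) : ℂ) = 0 := by
    push_cast
    linear_combination hc + (M 1 0 : ℂ) * Complex.I_sq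
  obtain ⟨h1, h2⟩ := real_mul_add_eq_zero (by simp) key
  exact ⟨by linarith, by linarith⟩

/-- Entries of a real matrix of positive determinant fixing `ρ`: `(d − c, −c; c, d)`. [folklore] -/
theorem entries_of_smul_rho_eq {M : GL (Fin 2) ℝ} (hM : 0 < M.det.val) (h : M • ρ = ρ) :
    M 0 0 = M 1 1 - M 1 0 ∧ M 0 1 = -M 1 0 := by
  have hc := congrArg UpperHalfPlane.coe h
  rw [coe_smul_of_det_pos hM, div_eq_iff (denom_ne_zero M _)] at hc
  simp only [num, denom] at hc
  have key : ((M 0 0 - M 1 1 + M 1 0 : ℝ) : ℂ) * (ρ : ℂ) + ((M 0 1 + M 1 0 : ℝ) : ℂ) = 0 := by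
    push_cast
    linear_combination hc + (M 1 0 : ℂ) * ρ_sq
  have hρ : (ρ : ℂ).im ≠ 0 := ρ.im_ne_zero
  obtain ⟨h1, h2⟩ := real_mul_add_eq_zero hρ key
  exact ⟨by linarith, by linarith⟩

/-- A real matrix of positive determinant fixing `i` commutes with `S`. [folklore] -/
theorem mul_S_eq_of_smul_I_eq {M : GL (Fin 2) ℝ} (hM : 0 < M.det.val) (h : M • UpperHalfPlane.I = UpperHalfPlane.I) :
    M * mapGL ℝ S = mapGL ℝ S * M := by
  obtain ⟨h1, h2⟩ := entries_of_smul_I_eq hM h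
  ext i j
  fin_cases i <;> fin_cases j <;>
    simp [Matrix.mul_apply, Fin.sum_univ_two, mapGL_coe_matrix, ModularGroup.coe_S, h1, h2]

/-- A real matrix of positive determinant fixing `ρ` commutes with `ST`. [folklore] -/
theorem mul_ST_eq_of_smul_rho_eq {M : GL (Fin 2) ℝ} (hM : 0 < M.det.val) (h : M • ρ = ρ) :
    M * mapGL ℝ (S * T) = mapGL ℝ (S * T) * M := by
  obtain ⟨h1, h2⟩ := entries_of_smul_rho_eq hM h
  ext i j
  fin_cases i <;> fin_cases j <;>
    simp [Matrix.mul_apply, Fin.sum_univ_two, mapGL_coe_matrix, ModularGroup.coe_S, ModularGroup.coe_T, h1, h2]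
  all_goals ring

/-- `mapGL ℝ g • z = g • z` (the two coercion paths agree). [folklore] -/
theorem mapGL_smul_eq (g : SL(2, ℤ)) (z : ℍ) : mapGL ℝ g • z = g • z := rfl

/-- **The key lemma.** Let `X ∈ SL₂(ℤ)` fix `P ∈ ℍ` and suppose every real matrix of positive
determinant fixing `P` commutes with `X` (the isotropy group of `P` in `GL₂⁺(ℝ)` is abelian). If
`δ·P = D_N·(k·P)` for some `δ, k ∈ SL₂(ℤ)` (i.e. `N(kP)` is `SL₂(ℤ)`-equivalent to `P`), then
`kXk⁻¹ ∈ Γ₀(N)`: from `D_N k = δM` with `M` fixing `P` one gets `D_N (kXk⁻¹) = (δXδ⁻¹) D_N`, whose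
`(2,1)` entries give `N ∣ (kXk⁻¹)₂₁` (cf. Diamond–Shurman Ex. 1.5.6 / the CM description of the
elliptic points of `X₀(N)`, §3.7). [folklore] -/
theorem conj_mem_gamma0_of_smul_eq {P : ℍ} {X : SL(2, ℤ)}
    (hcomm : ∀ M : GL (Fin 2) ℝ, 0 < M.det.val → M • P = P → M * mapGL ℝ X = mapGL ℝ X * M)
    {k δ : SL(2, ℤ)} (h : δ • P = tpD N • (k • P)) : k * X * k⁻¹ ∈ Gamma0 N := by
  set D := tpD N with hD
  set M : GL (Fin 2) ℝ := (mapGL ℝ δ)⁻¹ * D * mapGL ℝ k with hM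
  have hDdet := det_tpD_pos' N
  have hMdet : 0 < M.det.val := by
    simp only [hM, map_mul, map_inv, Units.val_mul, Units.val_inv_eq_inv_val]
    have h1 : ((mapGL ℝ δ).det.val) = 1 := by simp
    have h2 : ((mapGL ℝ k).det.val) = 1 := by simp
    rw [h1, h2, inv_one, one_mul, mul_one]
    exact hDdet
  have hMP : M • P = P := by
    rw [hM, mul_smul, mul_smul, mapGL_smul_eq, ← h, ← mapGL_smul_eq, inv_smul_smul]
  have hc := hcomm M hMdet hMP
  -- `D (k X k⁻¹) = (δ X δ⁻¹) D` in `GL(2, ℝ)`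
  have key : D * mapGL ℝ (k * X * k⁻¹) = mapGL ℝ (δ * X * δ⁻¹) * D := by
    have hDk : D * mapGL ℝ k = mapGL ℝ δ * M := by
      rw [hM]; group
    simp only [map_mul, map_inv]
    calc D * (mapGL ℝ k * mapGL ℝ X * (mapGL ℝ k)⁻¹)
        = (D * mapGL ℝ k) * mapGL ℝ X * (mapGL ℝ k)⁻¹ := by group
      _ = mapGL ℝ δ * (M * mapGL ℝ X) * (mapGL ℝ k)⁻¹ := by rw [hDk]; group
      _ = mapGL ℝ δ * mapGL ℝ X * (M * (mapGL ℝ k)⁻¹) := by rw [hc]; group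
      _ = mapGL ℝ δ * mapGL ℝ X * ((mapGL ℝ δ)⁻¹ * D) := by rw [hM]; group
      _ = mapGL ℝ δ * mapGL ℝ X * (mapGL ℝ δ)⁻¹ * D := by group
  -- compare the `(2,1)` entries
  set kX : SL(2, ℤ) := k * X * k⁻¹ with hkX
  set dX : SL(2, ℤ) := δ * X * δ⁻¹ with hdX
  have h10 := congrArg (fun g : GL (Fin 2) ℝ ↦ (g : Matrix (Fin 2) (Fin 2) ℝ) 1 0) key
  simp only [Units.val_mul, Matrix.mul_apply, Fin.sum_univ_two, hD, val_tpD, mapGL_coe_matrix,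
    map_apply_coe] at h10
  norm_num at h10
  -- `h10 : (kX₁₀ : ℝ) = (dX₁₀ : ℝ) * N`
  rw [Gamma0_mem]
  have hint : (kX 1 0 : ℤ) = (dX 1 0 : ℤ) * N := by exact_mod_cast h10
  rw [hint]
  push_cast
  simp

/-- **`E₆(Nτ) ≠ 0` at a non-elliptic point `τ = k·i` of `Γ₀(N)`** (`kSk⁻¹ ∉ Γ₀(N)`): otherwise
`N(kI) ∼ i` under `SL₂(ℤ)` and the key lemma would make `τ` elliptic. [folklore] -/
theorem E₆_tpD_smul_ne_zero {k : SL(2, ℤ)} (hk : k * S * k⁻¹ ∉ Gamma0 N) :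
    E₆ (tpD N • (k • UpperHalfPlane.I)) ≠ 0 := by
  intro h0
  obtain ⟨δ, hδ⟩ := E₆_eq_zero_iff.mp h0
  exact hk (conj_mem_gamma0_of_smul_eq N (fun M hM hMP ↦ mul_S_eq_of_smul_I_eq hM hMP) hδ)

/-- **`E₄(Nτ) ≠ 0` at a non-elliptic point `τ = k·ρ` of `Γ₀(N)`** (`k(ST)k⁻¹ ∉ Γ₀(N)`). [folklore] -/
theorem E₄_tpD_smul_ne_zero {k : SL(2, ℤ)} (hk : k * (S * T) * k⁻¹ ∉ Gamma0 N) :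
    E₄ (tpD N • (k • ρ)) ≠ 0 := by
  intro h0
  obtain ⟨δ, hδ⟩ := E₄_eq_zero_iff.mp h0
  exact hk (conj_mem_gamma0_of_smul_eq N (fun M hM hMP ↦ mul_ST_eq_of_smul_rho_eq hM hMP) hδ)

end Stabilizer

/-! ### Uniformizers at every point; reading `L(D)` at `P_τ` -/

section Uniformizer

variable {N : ℕ} [NeZero N]

omit [NeZero N] in
/-- `ord_τ(E₆|_{Γ₀(N)}) = 1` if `E₆(τ) = 0`. [folklore] -/
theorem orderAt_ofLevelOne_E₆ {τ : ℍ} (h : E₆ τ = 0) : orderAt (ofLevelOne (Gamma0 N) E₆) τ = 1 := by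
  rw [orderAt_ofLevelOne, analyticOrderAt_E₆, if_pos h]; rfl

omit [NeZero N] in
/-- `ord_τ(E₄|_{Γ₀(N)}) = 1` if `E₄(τ) = 0`. [folklore] -/
theorem orderAt_ofLevelOne_E₄ {τ : ℍ} (h : E₄ τ = 0) : orderAt (ofLevelOne (Gamma0 N) E₄) τ = 1 := by
  rw [orderAt_ofLevelOne, analyticOrderAt_E₄, if_pos h]; rfl

/-- `ord_τ(V_N E₆) = 0` if `E₆(Nτ) ≠ 0`. [folklore] -/
theorem orderAt_scaleN_E₆ {τ : ℍ} (h : E₆ (tpD N • τ) ≠ 0) : orderAt (scaleN N E₆) τ = 0 := by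
  rw [orderAt_scaleN, analyticOrderAt_E₆, if_neg h]; rfl

/-- `ord_τ(V_N E₄) = 0` if `E₄(Nτ) ≠ 0`. [folklore] -/
theorem orderAt_scaleN_E₄ {τ : ℍ} (h : E₄ (tpD N • τ) ≠ 0) : orderAt (scaleN N E₄) τ = 0 := by
  rw [orderAt_scaleN, analyticOrderAt_E₄, if_neg h]; rfl

omit [NeZero N] in
/-- A level-one form restricted to `Γ₀(N)` is nonzero iff it is. [folklore] -/
theorem ofLevelOne_ne_zero {k : ℤ} {f : ModularForm 𝒮ℒ k} (hf : f ≠ 0) : ofLevelOne (Gamma0 N) f ≠ 0 := by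
  intro h; apply hf; apply DFunLike.ext'
  have h' : ((ofLevelOne (Gamma0 N) f : ModularForm (Gamma0 N) k) : ℍ → ℂ) = 0 := by rw [h]; rfl
  exact h'

omit [NeZero N] in
/-- `E₆ ≠ 0`, `E₄ ≠ 0` as level-one forms. [folklore] -/
theorem E₆_ne_zero' : (E₆ : ModularForm 𝒮ℒ 6) ≠ 0 := fun h ↦ by
  have := congrArg (fun f : ModularForm 𝒮ℒ 6 ↦ f ρ) h
  exact E₆_rho_ne_zero this

omit [NeZero N] in
/-- `E₄ ≠ 0` as a level-one form. [folklore] -/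
theorem E₄_ne_zero' : (E₄ : ModularForm 𝒮ℒ 4) ≠ 0 := fun h ↦ by
  have := congrArg (fun f : ModularForm 𝒮ℒ 4 ↦ f UpperHalfPlane.I) h
  exact E₄_I_ne_zero this

/-- If `v_τ(u) = exp(1)` for some `u ≠ 0` then `v_τ(u⁻¹) = exp(−1)`. [folklore] -/
theorem pointValuation_inv_of_eq (τ : ℍ) {u : modularFunctionField N}
    (h : pointValuation τ u = WithZero.exp 1) : pointValuation τ u⁻¹ = WithZero.exp (-1) := by
  rw [map_inv₀, h, WithZero.exp_neg]

/-- At a point of period `1` with `E₆(τ) = 0` (a non-elliptic point above `j = 1728`),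
`(V_N E₆ / E₆)⁻¹ = E₆(τ)/E₆(Nτ)` is a uniformizer of `P_τ`. [folklore] -/
theorem exists_uniformizer_of_E₆_eq_zero {τ : ℍ} (h6 : E₆ τ = 0) (he : ellipticPeriod (Gamma0 N) τ = 1) :
    ∃ t : modularFunctionField N, pointValuation τ t = WithZero.exp (-1) := by
  obtain ⟨k, hkτ⟩ := E₆_eq_zero_iff.mp h6
  have hk : k * S * k⁻¹ ∉ Gamma0 N := by
    intro hmem
    rw [← hkτ, ellipticPeriod_smul_I, adjoinNegI_gamma0, if_pos hmem] at he
    norm_num at he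
  have hN6 : E₆ (tpD N • τ) ≠ 0 := by rw [← hkτ]; exact E₆_tpD_smul_ne_zero N hk
  set u : modularFunctionField N := mkFn (scaleN N E₆) (ofLevelOne (Gamma0 N) E₆) (ofLevelOne_ne_zero E₆_ne_zero')
    with hu
  have hu0 : u ≠ 0 := mkFn_ne_zero _ (scaleN_ne_zero N E₆_ne_zero')
  refine ⟨u⁻¹, pointValuation_inv_of_eq _ ?_⟩
  rw [pointValuation_apply _ hu0]
  congr 1
  have h1 : ordAt τ u = -1 := by
    rw [hu, ordAt_mkFn _ (scaleN_ne_zero N E₆_ne_zero'), orderAt_scaleN_E₆ hN6, orderAt_ofLevelOne_E₆ h6]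
    norm_num
  have h2 := ordAtN_mul_ellipticPeriod τ u
  rw [he, h1] at h2
  simp only [Nat.cast_one, mul_one] at h2
  rw [h2]; norm_num

/-- At a point of period `1` with `E₄(τ) = 0` (a non-elliptic point above `j = 0`),
`E₄(τ)/E₄(Nτ)` is a uniformizer of `P_τ`. [folklore] -/
theorem exists_uniformizer_of_E₄_eq_zero {τ : ℍ} (h4 : E₄ τ = 0) (he : ellipticPeriod (Gamma0 N) τ = 1) :
    ∃ t : modularFunctionField N, pointValuation τ t = WithZero.exp (-1) := by
  obtain ⟨k, hkτ⟩ := E₄_eq_zero_iff.mp h4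
  have hk : k * (S * T) * k⁻¹ ∉ Gamma0 N := by
    intro hmem
    rw [← hkτ, ellipticPeriod_smul_ρ, adjoinNegI_gamma0, if_pos hmem] at he
    norm_num at he
  have hN4 : E₄ (tpD N • τ) ≠ 0 := by rw [← hkτ]; exact E₄_tpD_smul_ne_zero N hk
  set u : modularFunctionField N := mkFn (scaleN N E₄) (ofLevelOne (Gamma0 N) E₄) (ofLevelOne_ne_zero E₄_ne_zero')
    with hu
  have hu0 : u ≠ 0 := mkFn_ne_zero _ (scaleN_ne_zero N E₄_ne_zero')
  refine ⟨u⁻¹, pointValuation_inv_of_eq _ ?_⟩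
  rw [pointValuation_apply _ hu0]
  congr 1
  have h1 : ordAt τ u = -1 := by
    rw [hu, ordAt_mkFn _ (scaleN_ne_zero N E₄_ne_zero'), orderAt_scaleN_E₄ hN4, orderAt_ofLevelOne_E₄ h4]
    norm_num
  have h2 := ordAtN_mul_ellipticPeriod τ u
  rw [he, h1] at h2
  simp only [Nat.cast_one, mul_one] at h2
  rw [h2]; norm_num

/-- **Every place `P_τ` has a uniformizer in closed form: `v_τ` is normalised** — there is
`t ∈ K_N` with `v_τ(t) = exp(−1)`, namely `j − j(τ)` (when its order `3, 2, 1` equals `e_τ`),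
`E₆(τ)/E₆(Nτ)` or `E₄(τ)/E₄(Nτ)` (at non-elliptic points above `j = 1728`, `j = 0`). [folklore] -/
theorem exists_pointValuation_eq_exp_neg_one (τ : ℍ) :
    ∃ t : modularFunctionField N, pointValuation τ t = WithZero.exp (-1) := by
  by_cases h : (if E₄ τ = 0 then 3 else if E₆ τ = 0 then 2 else 1) = ellipticPeriod (Gamma0 N) τ
  · exact ⟨kleinJSub N τ, pointValuation_kleinJSub_of_eq τ h⟩
  -- otherwise the period is `1` and `τ` lies above `j = 0` or `j = 1728`
  have htri := ellipticPeriod_trichotomy (Γ := Gamma0 N) τ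
  by_cases h4 : E₄ τ = 0
  · rw [if_pos h4] at h
    have he : ellipticPeriod (Gamma0 N) τ = 1 := by
      obtain ⟨k, rfl⟩ := E₄_eq_zero_iff.mp h4
      rw [ellipticPeriod_smul_ρ] at h ⊢
      split_ifs at h ⊢ with hm
      · exact absurd rfl h
      · rfl
    exact exists_uniformizer_of_E₄_eq_zero h4 he
  rw [if_neg h4] at h
  by_cases h6 : E₆ τ = 0
  · rw [if_pos h6] at h
    have he : ellipticPeriod (Gamma0 N) τ = 1 := by
      obtain ⟨k, rfl⟩ := E₆_eq_zero_iff.mp h6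
      rw [ellipticPeriod_smul_I] at h ⊢
      split_ifs at h ⊢ with hm
      · exact absurd rfl h
      · rfl
    exact exists_uniformizer_of_E₆_eq_zero h6 he
  · rw [if_neg h6] at h
    exfalso
    rcases htri with ⟨k, rfl⟩ | ⟨k, rfl⟩ | h1
    · exact h6 (E₆_eq_zero_iff.mpr ⟨k, rfl⟩)
    · exact h4 (E₄_eq_zero_iff.mpr ⟨k, rfl⟩)
    · exact h h1.symm

/-- `v_P(π_P)` read in `v_τ`: the chosen uniformizer of `P_τ` has `v_τ`-value `exp(−1)`. [folklore] -/
theorem pointValuation_uniformizer (τ : ℍ) :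
    pointValuation τ ((pointPlace (N := N) τ).uniformizer : modularFunctionField N) = WithZero.exp (-1) :=
  DiophantineGeometry.AlgFunctionField.PlaceOver.map_uniformizer_eq_of_isEquiv _ (isEquiv_pointValuation τ)
    (exists_pointValuation_eq_exp_neg_one τ)

/-- **Reading the Riemann–Roch condition at `P_τ`**: for `x ≠ 0`,
`v_{P_τ}(x) ≤ v_{P_τ}(π)^{−n} ↔ −n ≤ ordAtN τ x` (`ν_τ(x) ≥ −n`). [folklore] -/
theorem pointPlace_valuation_le_iff (τ : ℍ) {x : modularFunctionField N} (hx : x ≠ 0) (n : ℤ) :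
    (pointPlace (N := N) τ).valuation x ≤
        (pointPlace (N := N) τ).valuation ((pointPlace (N := N) τ).uniformizer : modularFunctionField N) ^ (-n) ↔
      -n ≤ ordAtN τ x := by
  rw [DiophantineGeometry.AlgFunctionField.PlaceOver.valuation_le_iff_of_isEquiv (pointPlace τ) (isEquiv_pointValuation τ)
    (exists_pointValuation_eq_exp_neg_one τ), pointValuation_le_exp_iff τ hx]

/-- The intrinsic normalised order of the place `P_τ` is `ordAtN τ`: for `x ≠ 0`,
`PlaceOver.ord (P_τ) x = ordAtN τ x`. [folklore] -/
theorem ord_pointPlace (τ : ℍ) {x : modularFunctionField N} (hx : x ≠ 0) :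
    (pointPlace (N := N) τ).ord x = ordAtN τ x := by
  have h := DiophantineGeometry.AlgFunctionField.PlaceOver.valuation_le_pow_iff_holds (pointPlace (N := N) τ) hx
  -- `h n : v(x) ≤ v(π)^n ↔ n ≤ ord x`
  apply le_antisymm
  · have := (h ((pointPlace (N := N) τ).ord x)).mpr le_rfl
    have h' := (pointPlace_valuation_le_iff τ hx (-(pointPlace (N := N) τ).ord x))
    rw [neg_neg] at h'
    have := h'.mp this
    omega
  · have h' := (pointPlace_valuation_le_iff τ hx (-ordAtN τ x))
    rw [neg_neg] at h'
    have := (h (ordAtN τ x)).mp (h'.mpr le_rfl)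
    exact this


omit [NeZero N] in
/-- **`kleinJSub N τ₀ = j − j(τ₀)` in `K_N`**: the uniformizer of `ModularFunctionFieldPoints` is
the element `kleinJK N − j(τ₀)` of the `ℂ(j)`-development of `ModularFunctionField` (requested link;
both are `q`-expansions of `(E₄³ − j(τ₀)Δ)/Δ`). [folklore] -/
theorem kleinJSub_eq (τ₀ : ℍ) :
    kleinJSub N τ₀ = kleinJK N - algebraMap ℂ (modularFunctionField N) (kleinJ τ₀) := by
  apply Subtype.val_injective
  change qExpansionL N (E₄cubeSubSmulDelta N (kleinJ τ₀)) / qExpansionL N (deltaN N) =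
    kleinJL - ((algebraMap ℂ (modularFunctionField N) (kleinJ τ₀) : modularFunctionField N) : LaurentSeries ℂ)
  have hq : qExpansionL N (E₄cubeSubSmulDelta N (kleinJ τ₀)) =
      qExpansionL N (ofLevelOne (Gamma0 N) E₄cube) - kleinJ τ₀ • qExpansionL N (deltaN N) := by
    rw [qExpansionL_def, qExpansionL_def, qExpansionL_def]
    change (((qExpansion 1 ⇑((E₄cube : ModularForm 𝒮ℒ 12) - kleinJ τ₀ • delta) : PowerSeries ℂ)) :
        LaurentSeries ℂ) = ((qExpansion 1 ⇑E₄cube : PowerSeries ℂ) : LaurentSeries ℂ) -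
      kleinJ τ₀ • ((qExpansion 1 ⇑delta : PowerSeries ℂ) : LaurentSeries ℂ)
    rw [ModularForm.coe_sub, ModularForm.qExpansion_sub one_pos one_mem_strictPeriods_SL,
      IsGLPos.coe_smul, ModularForm.qExpansion_smul one_pos one_mem_strictPeriods_SL,
      PowerSeries.coe_sub, PowerSeries.coe_smul]
  have hd : qExpansionL N (deltaN N) ≠ 0 := (qExpansionL_eq_zero_iff N _).not.mpr ofLevelOne_delta_ne_zero
  rw [hq, sub_div, show ((algebraMap ℂ (modularFunctionField N) (kleinJ τ₀) : modularFunctionField N) :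
      LaurentSeries ℂ) = algebraMap ℂ (LaurentSeries ℂ) (kleinJ τ₀) from rfl,
    algebraMap_laurentSeries_apply, ← HahnSeries.C_mul_eq_smul, mul_div_assoc, div_self hd, mul_one]
  rfl

end Uniformizer

end Literature.NumberTheory.EllipticCurves.ModularForms

end
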